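import Summits.AtomisticToContinuum.HydrodynamicLimit.Theorems.JParityClosureLocalSecondLawEquilibriumDefs
import Summits.AtomisticToContinuum.HydrodynamicLimit.Theorems.JParityClosureLocalSecondLawInitialLayerLLN
import Summits.AtomisticToContinuum.HydrodynamicLimit.Theorems.CollisionActivityTails.Negative.EquilibriumReduction

/-!
# Uniform-in-`x` law of large numbers for the cone fields under the homogeneous local Gibbs law
(stmt-AtomisticToContinuum-13081, line `exact-entropy-ledger-three-passivities`, stub `eq_uniformLLN` of the
equilibrium side composition)

Under the homogeneous local Gibbs law `lawC σ a Θ ū N Φ` (constant activity `a`, drift `ū`, temperature `Θ`) the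
three cone fields `(ρ_r, m_r, e_r)(w, x)` (`rhoC`, `momC`, `kinC`) of the configuration `w` ITSELF (no flow) are,
for EVERY fixed `0 < r < 1/2` and eventually in `N`, `ι`-close to the constant state `(1, ū, ē)`,
`ē = totalEnergyDensity 1 ū Θ = ‖ū‖²/2 + 3Θ/2`, simultaneously at EVERY field point `x ∈ 𝕋³`, off a MEASURABLE
event of law-probability `≤ δ'` (`eq_uniformLLN`).

Proof.
* Pointwise LLN (`uLLN_static`): the tree's constant-profile `t = 0` law of large numbers
  `CollisionActivityTailsEquilibrium.constantProfileLLN_holds` (through any flow family, which exists by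
  Alexander's theorem, `flows_nonempty`) read on the configuration itself, the flow at time `0` being the identity
  almost surely (`localGibbsLaw_preimage_flow_zero`); its constant density is `1` (`uLLN_density_one`: the
  empirical density of the test function `1` is identically `1` and limits in probability are unique, cf.
  `LocalSecondLawNegative.homogeneous_lln_identified`).  Tested against the cone `b_r(·, y)` (unit mass,
  `integral_cone_eq_one'`) the limits ARE the constant data — no mollification error, whence no `r₀`.
* Uniformity in `x`: the finite-net upgrade of `LocalSecondLawLedger.initialLayer_uniformLLN` — the cone fields are
  `3/(π r⁴)`-Lipschitz in the centre with energy-tight constants (`initL_fields_lip`), a finite net of the compact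
  torus (`gridUp_euclidNet`), a finite union bound and `Tendsto ⇒ ∃ N₀`.
* Measurability: the bad event is a finite union of strict super-level sets of continuous functions of the
  configuration (`continuous_rhoC_uncurry`, `uLLN_continuous_momC`, `continuous_kinC_uncurry`,
  `uLLN_continuous_energy`).

References: H. Spohn, *Large Scale Dynamics of Interacting Particles* (1991), Part I §2.3, §3 (homogeneous Gibbs
law, law of large numbers for local equilibria); C. Kipnis, C. Landim, *Scaling Limits of Interacting Particle
Systems* (1999), Ch. 4 (from pointwise to uniform statements via moduli of continuity).
-/

noncomputable section

namespace Summit.AtomisticToContinuum.HydrodynamicLimit.Theorems.LocalSecondLawEquilibrium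

open scoped BigOperators Topology Classical MeasureTheory ENNReal InnerProductSpace
open Filter Set MeasureTheory
open Literature.MathematicalPhysics.KineticTheory
open Literature.Analysis.FluidPDE
open Summit.AtomisticToContinuum.HydrodynamicLimit.Theorems.LocalSecondLawNegative
open Summit.AtomisticToContinuum.HydrodynamicLimit.Theorems.LocalSecondLawLedger

variable {N : ℕ}

/-! ## Tools -/

/-- Chaining two closeness bounds (`≤ ι/4` and `≤ ι/2`) into a strict `ι`-bound. -/
theorem uLLN_chain {E : Type*} [SeminormedAddCommGroup E] {a b c : E} {ι : ℝ} (hι : 0 < ι)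
    (h1 : ‖a - b‖ ≤ ι / 4) (h2 : ‖b - c‖ ≤ ι / 2) : ‖a - c‖ < ι := by
  calc ‖a - c‖ = ‖(a - b) + (b - c)‖ := by rw [sub_add_sub_cancel]
    _ ≤ ‖a - b‖ + ‖b - c‖ := norm_add_le _ _
    _ < ι := by linarith

/-- Chaining two closeness bounds, real-valued version. -/
theorem uLLN_chain_abs {a b c ι : ℝ} (hι : 0 < ι) (h1 : |a - b| ≤ ι / 4) (h2 : |b - c| ≤ ι / 2) :
    |a - c| < ι :=
  uLLN_chain (E := ℝ) hι h1 h2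

/-- The coarse momentum is continuous in the configuration. -/
theorem uLLN_continuous_momC (r : ℝ) (y : T3) : Continuous fun w : Phase N => momC r w y := by
  have h : (fun w : Phase N => momC r w y) =
      fun w => ((N + 1 : ℕ) : ℝ)⁻¹ • ∑ i, cone r (w i).1 y • (w i).2 := by
    funext w; exact empiricalMomentumField_eq_sum w (fun x => cone r x y)
  rw [h]
  have hf : ∀ i : Fin (N + 1), Continuous fun w : Phase N => (w i).1 := fun i => (continuous_apply i).fst
  have hv : ∀ i : Fin (N + 1), Continuous fun w : Phase N => (w i).2 := fun i => (continuous_apply i).snd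
  exact (continuous_finsetSum _ fun i _ =>
    (continuous_cone_comp r (hf i) continuous_const).smul (hv i)).const_smul (((N + 1 : ℕ) : ℝ)⁻¹)

/-- The empirical kinetic energy `⟨μ_w, |v|²/2⟩` is continuous in the configuration. -/
theorem uLLN_continuous_energy : Continuous fun w : Phase N => empiricalEnergyField w (fun _ => 1) := by
  have h : (fun w : Phase N => empiricalEnergyField w (fun _ => 1)) =
      fun w => ((N + 1 : ℕ) : ℝ)⁻¹ * ∑ i, 1 * (‖(w i).2‖ ^ 2 / 2) := by
    funext w; exact empiricalEnergyField_eq_sum w (fun _ => 1)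
  rw [h]
  have hv : ∀ i : Fin (N + 1), Continuous fun w : Phase N => (w i).2 := fun i => (continuous_apply i).snd
  exact continuous_const.mul (continuous_finsetSum _ fun i _ =>
    continuous_const.mul (((hv i).norm.pow 2).div_const _))

/-! ## The static law of large numbers under the homogeneous law -/

/-- **Static form of the `t = 0` law of large numbers under the homogeneous law.** The flow at time `0` is the
identity almost surely (`localGibbsLaw_preimage_flow_zero`), so the three events of `TendstoHydroFieldsAt … 0` may
be read on the configuration itself. -/
theorem uLLN_static {σ a Θ ρb : ℝ} {ū : V3} (Ψ : (N : ℕ) → Flow σ N)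
    (hT : TendstoHydroFieldsAt (fun N => lawC σ a Θ ū N (Ψ N)) Ψ (fun _ _ => ρb) (fun _ _ => ū)
      (fun _ _ => Θ) 0) (χ : T3 → ℝ) (hχ : Continuous χ) {δ : ℝ} (hδ : 0 < δ) :
    Tendsto (fun N => lawC σ a Θ ū N (Ψ N) {w | δ < |empiricalDensityField w χ - ∫ x, χ x * ρb|})
        atTop (𝓝 0) ∧
      Tendsto (fun N => lawC σ a Θ ū N (Ψ N)
        {w | δ < ‖empiricalMomentumField w χ - ∫ x, (χ x * ρb) • ū‖}) atTop (𝓝 0) ∧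
      Tendsto (fun N => lawC σ a Θ ū N (Ψ N)
        {w | δ < |empiricalEnergyField w χ - ∫ x, χ x * totalEnergyDensity ρb ū Θ|}) atTop (𝓝 0) := by
  obtain ⟨h1, h2, h3⟩ := hT χ hχ δ hδ
  have hflow : ∀ (N : ℕ) (A : Set (Phase N)),
      lawC σ a Θ ū N (Ψ N) ((Ψ N).flow 0 ⁻¹' A) = lawC σ a Θ ū N (Ψ N) A := fun N A => by
    show localGibbsLaw σ (fun _ => a) (fun _ => ū) (fun _ => Θ) N (Ψ N) ((Ψ N).flow 0 ⁻¹' A) =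
      localGibbsLaw σ (fun _ => a) (fun _ => ū) (fun _ => Θ) N (Ψ N) A
    rw [localGibbsLaw_preimage_flow_zero, localGibbsLaw_eq]
  exact ⟨h1.congr' (Eventually.of_forall fun N =>
      hflow N {w | δ < |empiricalDensityField w χ - ∫ x, χ x * ρb|}),
    h2.congr' (Eventually.of_forall fun N =>
      hflow N {w | δ < ‖empiricalMomentumField w χ - ∫ x, (χ x * ρb) • ū‖}),
    h3.congr' (Eventually.of_forall fun N =>
      hflow N {w | δ < |empiricalEnergyField w χ - ∫ x, χ x * totalEnergyDensity ρb ū Θ|})⟩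

/-- **The LLN density of the homogeneous law is `1`.** The empirical density of the test function `1` is
identically `1` (`empiricalDensityField_one`), the law is a probability measure (`σ ≤ 1/2`), and limits in
probability are unique; cf. `LocalSecondLawNegative.homogeneous_lln_identified`. -/
theorem uLLN_density_one {σ a Θ ρb : ℝ} {ū : V3} (ha : 0 < a) (hΘ : 0 < Θ) (hσ2 : σ ≤ 1 / 2)
    (Ψ : (N : ℕ) → Flow σ N)
    (hT : TendstoHydroFieldsAt (fun N => lawC σ a Θ ū N (Ψ N)) Ψ (fun _ _ => ρb) (fun _ _ => ū)
      (fun _ _ => Θ) 0) : ρb = 1 := by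
  by_contra hne
  have hk : 0 < |1 - ρb| := abs_pos.2 (sub_ne_zero.2 (Ne.symm hne))
  have hd := (uLLN_static Ψ hT (fun _ => (1 : ℝ)) continuous_const (half_pos hk)).1
  have hint : ∫ _ : T3, (1 : ℝ) * ρb = ρb := by simp
  have hone : ∀ N, (1 : ENNReal) ≤ lawC σ a Θ ū N (Ψ N)
      {w | |1 - ρb| / 2 < |empiricalDensityField w (fun _ => (1 : ℝ)) - ∫ _ : T3, (1 : ℝ) * ρb|} := by
    intro N
    haveI : IsProbabilityMeasure (lawC σ a Θ ū N (Ψ N)) :=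
      isProbabilityMeasure_localGibbsLaw continuous_const continuous_const continuous_const
        (fun _ => ha) (fun _ => hΘ) hσ2 N (Ψ N)
    rw [← measure_univ (μ := lawC σ a Θ ū N (Ψ N))]
    refine measure_mono fun w _ => ?_
    show |1 - ρb| / 2 < |empiricalDensityField w (fun _ => (1 : ℝ)) - ∫ _ : T3, (1 : ℝ) * ρb|
    rw [empiricalDensityField_one (Nat.succ_ne_zero N), hint]
    exact half_lt_self hk
  have h10 : (1 : ENNReal) ≤ 0 := ge_of_tendsto' hd hone
  exact absurd h10 (by simp)

/-! ## The uniform law of large numbers at every fixed `r < 1/2` -/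

/-- **Uniform-in-`x` law of large numbers for the cone fields under the homogeneous local Gibbs law.** For
constant profiles `(a, ū, Θ)` there is `σ₁ ∈ (0, 1/2]` such that for `0 < σ < σ₁`, every FIXED `0 < r < 1/2` and
all tolerances `ι, δ' > 0`: for `N ≥ N₀`, off a measurable event `B` of `lawC`-probability `≤ δ'`, the three cone
fields of the configuration are `ι`-close to `(1, ū, ‖ū‖²/2 + 3Θ/2)` at EVERY field point.  (Pointwise LLN with
density `1` + unit mass of the kernel, so that the limits are the constant data with no mollification error; finite
net + centre-Lipschitz cone fields with energy-tight constants; union bound.) -/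
theorem eq_uniformLLN :
  ∀ (a Θ : ℝ) (ū : V3), 0 < a → 0 < Θ → ∃ σ₁ : ℝ, 0 < σ₁ ∧ σ₁ ≤ 1 / 2 ∧ ∀ σ : ℝ, 0 < σ → σ < σ₁ →
    ∀ r : ℝ, 0 < r → r < 1 / 2 → ∀ ι δ' : ℝ, 0 < ι → 0 < δ' → ∃ N₀ : ℕ, ∀ N : ℕ, N₀ ≤ N → ∀ Φ : Flow σ N,
      ∃ B : Set (Phase N), MeasurableSet B ∧ lawC σ a Θ ū N Φ B ≤ ENNReal.ofReal δ' ∧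
        ∀ w, w ∉ B → ∀ x : T3, |rhoC r w x - 1| < ι ∧ ‖momC r w x - ū‖ < ι ∧
          |kinC r w x - totalEnergyDensity 1 ū Θ| < ι := by
  intro a Θ ū ha hΘ
  obtain ⟨σ₀, hσ₀, HL⟩ := CollisionActivityTailsEquilibrium.constantProfileLLN_holds a Θ ū ha hΘ
  refine ⟨min σ₀ (1 / 2), lt_min hσ₀ one_half_pos, min_le_right _ _, ?_⟩
  intro σ hσ hσ₁ r hr hr2 ι δ' hι hδ'
  have hσ₀' : σ < σ₀ := hσ₁.trans_le (min_le_left _ _)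
  have hσ2 : σ < 1 / 2 := hσ₁.trans_le (min_le_right _ _)
  obtain ⟨ρb, -, hTall⟩ := HL σ hσ hσ₀'
  -- an auxiliary flow family (the law and the static events do not depend on it)
  obtain ⟨Ψ⟩ := CollisionActivityTailsEquilibrium.flows_nonempty hσ hσ2
  have hT : TendstoHydroFieldsAt (fun N => lawC σ a Θ ū N (Ψ N)) Ψ (fun _ _ => ρb) (fun _ _ => ū)
      (fun _ _ => Θ) 0 := hTall Ψ
  have hρb : ρb = 1 := uLLN_density_one ha hΘ hσ2.le Ψ hT
  subst hρb
  set P : (N : ℕ) → Measure (Phase N) := fun N => lawC σ a Θ ū N (Ψ N)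
  have hι2 : 0 < ι / 2 := half_pos hι
  -- constants at fixed `r`, mesh, net
  set L : ℝ := 3 / (Real.pi * r ^ 4)
  have hLpos : 0 < L := by positivity
  set K : ℝ := |totalEnergyDensity 1 ū Θ| + 1 with hK
  have hK1 : 1 ≤ K := by have := abs_nonneg (totalEnergyDensity 1 ū Θ); linarith
  have hL' : 0 < L * (1 + K) := by positivity
  have hmpos : 0 < ι / (4 * (L * (1 + K))) := by positivity
  have hmL : L * (1 + K) * (ι / (4 * (L * (1 + K)))) = ι / 4 := by field_simp
  obtain ⟨Sx, hSx⟩ := gridUp_euclidNet hmpos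
  -- the bad events (static: on the configuration itself)
  set A1 : (N : ℕ) → T3 → Set (Phase N) := fun N y =>
    {w | ι / 2 < |empiricalDensityField w (fun x => cone r x y) - ∫ x, cone r x y * (1 : ℝ)|}
  set A2 : (N : ℕ) → T3 → Set (Phase N) := fun N y =>
    {w | ι / 2 < ‖empiricalMomentumField w (fun x => cone r x y) - ∫ x, (cone r x y * (1 : ℝ)) • ū‖}
  set A3 : (N : ℕ) → T3 → Set (Phase N) := fun N y =>
    {w | ι / 2 < |empiricalEnergyField w (fun x => cone r x y) -
      ∫ x, cone r x y * totalEnergyDensity 1 ū Θ|}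
  set AE : (N : ℕ) → Set (Phase N) := fun N =>
    {w | 1 < |empiricalEnergyField w (fun _ => 1) - ∫ _ : T3, (1 : ℝ) * totalEnergyDensity 1 ū Θ|}
  -- measurability: strict super-level sets of continuous functions of the configuration
  have hmA : ∀ (N : ℕ) (y : T3), MeasurableSet (A1 N y ∪ A2 N y ∪ A3 N y) := by
    intro N y
    have hρc : Continuous fun w : Phase N => rhoC r w y := by
      simpa only [Function.comp_def] using
        (continuous_rhoC_uncurry (N := N) r).comp (Continuous.prodMk_left y)
    have hkc : Continuous fun w : Phase N => kinC r w y := by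
      simpa only [Function.comp_def] using
        (continuous_kinC_uncurry (N := N) r).comp (Continuous.prodMk_left y)
    have hmc : Continuous fun w : Phase N => momC r w y := uLLN_continuous_momC r y
    exact ((measurableSet_lt measurable_const (hρc.sub continuous_const).abs.measurable).union
      (measurableSet_lt measurable_const (hmc.sub continuous_const).norm.measurable)).union
      (measurableSet_lt measurable_const (hkc.sub continuous_const).abs.measurable)
  have hmAE : ∀ N : ℕ, MeasurableSet (AE N) := fun N =>
    measurableSet_lt measurable_const
      ((uLLN_continuous_energy (N := N)).sub continuous_const).abs.measurable
  -- the LLN at the net points and the energy tie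
  have hA : ∀ y : T3, Tendsto (fun N => P N (A1 N y) + P N (A2 N y) + P N (A3 N y)) atTop (𝓝 0) := by
    intro y
    obtain ⟨h1, h2, h3⟩ := uLLN_static Ψ hT (fun x => cone r x y)
      (continuous_cone_comp r continuous_id continuous_const) hι2
    have h := (h1.add h2).add h3
    rw [add_zero, add_zero] at h
    exact h
  have hAE' : Tendsto (fun N => P N (AE N)) atTop (𝓝 0) :=
    (uLLN_static Ψ hT (fun _ => (1 : ℝ)) continuous_const one_pos).2.2
  set f : ℕ → ENNReal := fun N => (∑ y ∈ Sx, (P N (A1 N y) + P N (A2 N y) + P N (A3 N y))) + P N (AE N)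
  have hfT : Tendsto f atTop (𝓝 0) := by
    have hsum := tendsto_finsetSum Sx fun y (_ : y ∈ Sx) => hA y
    rw [Finset.sum_const_zero] at hsum
    simpa only [add_zero] using hsum.add hAE'
  obtain ⟨N₀, hN₀⟩ := eventually_atTop.1 ((tendsto_order.1 hfT).2 _ (ENNReal.ofReal_pos.2 hδ'))
  refine ⟨N₀, fun N hN Φ => ⟨(⋃ y ∈ Sx, (A1 N y ∪ A2 N y ∪ A3 N y)) ∪ AE N, ?_, ?_, ?_⟩⟩
  · exact (Finset.measurableSet_biUnion Sx fun y _ => hmA N y).union (hmAE N)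
  · -- the law does not depend on the flow (it only fixes the phase space)
    have hΦ : lawC σ a Θ ū N Φ = P N := by
      show localGibbsLaw σ (fun _ => a) (fun _ => ū) (fun _ => Θ) N Φ =
        localGibbsLaw σ (fun _ => a) (fun _ => ū) (fun _ => Θ) N (Ψ N)
      rw [localGibbsLaw_eq, localGibbsLaw_eq]
    rw [hΦ]
    calc P N ((⋃ y ∈ Sx, (A1 N y ∪ A2 N y ∪ A3 N y)) ∪ AE N)
        ≤ P N (⋃ y ∈ Sx, (A1 N y ∪ A2 N y ∪ A3 N y)) + P N (AE N) := measure_union_le _ _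
      _ ≤ (∑ y ∈ Sx, P N (A1 N y ∪ A2 N y ∪ A3 N y)) + P N (AE N) :=
          add_le_add (measure_biUnion_finset_le Sx _) le_rfl
      _ ≤ f N := by
          refine add_le_add (Finset.sum_le_sum fun y _ => ?_) le_rfl
          exact (measure_union_le _ _).trans (add_le_add (measure_union_le _ _) le_rfl)
      _ ≤ ENNReal.ofReal δ' := (hN₀ N hN).le
  · intro w hw x
    have memU : ∀ y ∈ Sx, ∀ {S : T3 → Set (Phase N)}, w ∈ S y → w ∈ ⋃ y ∈ Sx, S y :=
      fun y hy S h => Set.mem_iUnion.2 ⟨y, Set.mem_iUnion.2 ⟨hy, h⟩⟩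
    obtain ⟨y, hy, hxy⟩ := hSx x
    -- unit mass of the kernel: the limits are the constant data (no mollification error)
    have hI1 : ∫ x, cone r x y * (1 : ℝ) = 1 := by
      simp_rw [mul_one]; exact integral_cone_eq_one' hr hr2 y
    have hI2 : ∫ x, (cone r x y * (1 : ℝ)) • ū = ū := by
      rw [integral_smul_const, hI1, one_smul]
    have hI3 : ∫ x, cone r x y * totalEnergyDensity 1 ū Θ = totalEnergyDensity 1 ū Θ := by
      rw [integral_mul_const, integral_cone_eq_one' hr hr2 y, one_mul]
    have hIE : ∫ _ : T3, (1 : ℝ) * totalEnergyDensity 1 ū Θ = totalEnergyDensity 1 ū Θ := by simp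
    -- energy bound off `AE`
    have hEn : empiricalEnergyField w (fun _ => 1) ≤ K := by
      have h1 : ¬ (1 < |empiricalEnergyField w (fun _ => 1) -
          ∫ _ : T3, (1 : ℝ) * totalEnergyDensity 1 ū Θ|) := fun h => hw (Or.inr h)
      rw [hIE] at h1
      have h2 := le_abs_self (empiricalEnergyField w (fun _ => 1) - totalEnergyDensity 1 ū Θ)
      have h3 := le_abs_self (totalEnergyDensity 1 ū Θ)
      rw [hK]; linarith [not_lt.1 h1]
    have hE0 := initL_energy_nonneg w
    -- the LLN at the net point `y`
    have e1 : |rhoC r w y - ∫ x, cone r x y * (1 : ℝ)| ≤ ι / 2 :=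
      not_lt.1 fun h => hw (Or.inl (memU y hy (S := fun y => A1 N y ∪ A2 N y ∪ A3 N y)
        (Or.inl (Or.inl h))))
    have e2 : ‖momC r w y - ∫ x, (cone r x y * (1 : ℝ)) • ū‖ ≤ ι / 2 :=
      not_lt.1 fun h => hw (Or.inl (memU y hy (S := fun y => A1 N y ∪ A2 N y ∪ A3 N y)
        (Or.inl (Or.inr h))))
    have e3 : |kinC r w y - ∫ x, cone r x y * totalEnergyDensity 1 ū Θ| ≤ ι / 2 :=
      not_lt.1 fun h => hw (Or.inl (memU y hy (S := fun y => A1 N y ∪ A2 N y ∪ A3 N y) (Or.inr h)))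
    rw [hI1] at e1
    rw [hI2] at e2
    rw [hI3] at e3
    -- Lipschitz from `x` to the net point `y`
    obtain ⟨l1, l2, l3⟩ := initL_fields_lip hr w x y
    have hd0 : 0 ≤ Torus.euclidDist x y := norm_nonneg _
    have hLd : L * Torus.euclidDist x y * (1 + K) ≤ ι / 4 := by
      calc L * Torus.euclidDist x y * (1 + K) = L * (1 + K) * Torus.euclidDist x y := by ring
        _ ≤ L * (1 + K) * (ι / (4 * (L * (1 + K)))) := mul_le_mul_of_nonneg_left hxy hL'.le
        _ = ι / 4 := hmL
    have l1' : |rhoC r w x - rhoC r w y| ≤ ι / 4 := l1.trans (by nlinarith)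
    have l2' : ‖momC r w x - momC r w y‖ ≤ ι / 4 := l2.trans (by nlinarith)
    have l3' : |kinC r w x - kinC r w y| ≤ ι / 4 := l3.trans (by nlinarith)
    exact ⟨uLLN_chain_abs hι l1' e1, uLLN_chain hι l2' e2, uLLN_chain_abs hι l3' e3⟩

end Summit.AtomisticToContinuum.HydrodynamicLimit.Theorems.LocalSecondLawEquilibrium

end
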